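import Literature.AlgebraicGeometry.HodgeTheory.CyclicReflectionComplexification
import HarnessLib

/-!
# Non-degeneracy of a rational bilinear form on a subspace survives complexification (Gram determinant)
# — packaging for the eigencomponents of vanishing vectors (Carlson–Toledo 1999 §6: "the intersection form on
# the space `V` of local vanishing cycles … is nondegenerate. Consequently `H^{n+1}(Y_õ)` splits orthogonally as
# `V ⊕ V^⊥`")

Family `hodge`, layer `Literature/AlgebraicGeometry/HodgeTheory`. THEOREMS only. Part of the R1 packaging for
crux K1 of `Summits/HodgeConjecture/HodgeConjecture/Theses/CyclicUnitaryPowers.lean` (STUB-PLAN-B2-g19 §2 R1,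
LANE-D-ROADMAP-Ax-g0 (a)): the clause "`B` non-degenerate on the cyclic span `ℚ[τ]·δ`" of the
`CyclicReflectionSystem` must be used on `V ⊗ ℂ` (to see that the eigencomponents `δ_j` are `h`-anisotropic,
so that the local monodromy is a complex reflection along `δ_j` on `H(ζ^j)`). Written by the prover seat
`hodge-nonav-prover-Ax`.

## What is proved (`V` a `ℚ`-space, `B` SYMMETRIC, `v : ι → V` a finite linearly independent family on whose
span `B` is non-degenerate)
* `det_gram_ne_zero` — the Gram matrix `(B(vᵢ, v_k))` has non-zero determinant.
* **`eq_zero_of_mem_span_tmul_of_forall_baseChange_eq_zero`** — a vector of the complex span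
  `span_ℂ {1 ⊗ vᵢ}` which is `B_ℂ`-orthogonal to every `1 ⊗ v_k` is zero (`B_ℂ` is non-degenerate on the
  complexified span).

## References
* [CarlsonToledo1999] J. A. Carlson, D. Toledo, Duke Math. J. 97 (1999), §6 (p. 13: non-degeneracy of the
  intersection form on the vanishing space, `V ⊕ V^⊥`).
-/

noncomputable section

open Module Literature.AlgebraicGeometry.Motives
open scoped TensorProduct

namespace Literature.AlgebraicGeometry.HodgeTheory

universe v

variable {V : Type v} [AddCommGroup V] [Module ℚ V] {ι : Type*} [Fintype ι] [DecidableEq ι]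

/-- **The Gram determinant of a non-degenerate symmetric form on the span of an independent family is
non-zero.** [cite: CarlsonToledo1999, §6 (p. 13)] -/
theorem det_gram_ne_zero {B : LinearMap.BilinForm ℚ V} (hB : B.IsSymm) (v : ι → V) (hli : LinearIndependent ℚ v)
    (hnd : ∀ x ∈ Submodule.span ℚ (Set.range v), (∀ y ∈ Submodule.span ℚ (Set.range v), B x y = 0) → x = 0) :
    (Matrix.of fun i k => B (v i) (v k)).det ≠ 0 := by
  intro hdet
  obtain ⟨d, hd0, hd⟩ := Matrix.exists_mulVec_eq_zero_iff.2 hdet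
  set w : V := ∑ k, d k • v k with hw
  have hwmem : w ∈ Submodule.span ℚ (Set.range v) :=
    Submodule.sum_mem _ fun k _ => Submodule.smul_mem _ _ (Submodule.subset_span ⟨k, rfl⟩)
  -- `B(vᵢ, w) = (G d)ᵢ = 0`, hence by symmetry `B(w, vᵢ) = 0` and `B(w, y) = 0` on the span
  have hBvw : ∀ i, B (v i) w = 0 := by
    intro i
    have h := congrFun hd i
    simp only [Matrix.mulVec, dotProduct, Matrix.of_apply, Pi.zero_apply] at h
    rw [hw, map_sum]
    simpa only [map_smul, smul_eq_mul, mul_comm (d _)] using h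
  have hBwy : ∀ y ∈ Submodule.span ℚ (Set.range v), B w y = 0 := by
    intro y hy
    obtain ⟨e, rfl⟩ := (Submodule.mem_span_range_iff_exists_fun ℚ).1 hy
    rw [map_sum]
    refine Finset.sum_eq_zero fun i _ => ?_
    rw [map_smul, ← hB.eq (v i) w, hBvw, smul_zero]
  have hw0 : w = 0 := hnd w hwmem hBwy
  exact hd0 (funext fun k => (Fintype.linearIndependent_iff.1 hli d (by rw [← hw, hw0])) k)

/-- **`B_ℂ` is non-degenerate on the complexified span**: for `B` symmetric and non-degenerate on
`span_ℚ {vᵢ}` (`v` linearly independent), a vector `x ∈ span_ℂ {1 ⊗ vᵢ}` with `B_ℂ(x, 1 ⊗ v_k) = 0` for all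
`k` is zero ("`H^{n+1}(Y)` splits orthogonally as `V ⊕ V^⊥`", read after `⊗ ℂ`). [cite: CarlsonToledo1999, §6 (p. 13)] -/
theorem eq_zero_of_mem_span_tmul_of_forall_baseChange_eq_zero {B : LinearMap.BilinForm ℚ V} (hB : B.IsSymm)
    (v : ι → V) (hli : LinearIndependent ℚ v)
    (hnd : ∀ x ∈ Submodule.span ℚ (Set.range v), (∀ y ∈ Submodule.span ℚ (Set.range v), B x y = 0) → x = 0)
    {x : ℂ ⊗[ℚ] V} (hx : x ∈ Submodule.span ℂ (Set.range fun i => (1 : ℂ) ⊗ₜ[ℚ] v i))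
    (h0 : ∀ k, B.baseChange ℂ x ((1 : ℂ) ⊗ₜ v k) = 0) : x = 0 := by
  obtain ⟨c, rfl⟩ := (Submodule.mem_span_range_iff_exists_fun ℂ).1 hx
  set G : Matrix ι ι ℚ := Matrix.of fun i k => B (v i) (v k) with hG
  have hdet : (G.map ((↑) : ℚ → ℂ)).det ≠ 0 := by
    rw [show (G.map ((↑) : ℚ → ℂ)) = (Rat.castHom ℂ).mapMatrix G from rfl, ← RingHom.map_det]
    exact (map_ne_zero_iff _ (Rat.castHom ℂ).injective).2 (det_gram_ne_zero hB v hli hnd)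
  -- `B_ℂ(Σ cᵢ (1 ⊗ vᵢ), 1 ⊗ v_k) = Σᵢ cᵢ G_{ik} = (c ᵥ* G)_k`
  have hvec : Matrix.vecMul c (G.map ((↑) : ℚ → ℂ)) = 0 := by
    funext k
    have h := h0 k
    rw [map_sum, LinearMap.sum_apply] at h
    simp only [map_smul, LinearMap.smul_apply, LinearMap.BilinForm.baseChange_tmul, mul_one, smul_eq_mul] at h
    rw [Matrix.vecMul, dotProduct, Pi.zero_apply, ← h]
    refine Finset.sum_congr rfl fun i _ => ?_
    rw [Matrix.map_apply, hG, Matrix.of_apply, Rat.smul_one_eq_cast]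
  have hc : c = 0 := Matrix.eq_zero_of_vecMul_eq_zero hdet hvec
  simp [hc]

end Literature.AlgebraicGeometry.HodgeTheory

end
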